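import Summits.CriticalPhenomena.PercolationContinuityZ3.Theorems.PercNearOneGluingNoHeavyPcintNawFreeMemKernelCert
import Summits.CriticalPhenomena.PercolationContinuityZ3.Theorems.PercNearOneGluingNoHeavyPcintNawFreeMemClaims
import HarnessLib

/-!
# PCINT lane, reduction B2d on the dangerous-set automaton — the WITNESS-CARRYING (claims) kernel certificate

Cell `prim-pcint` (PAPER-2 track (iii)), seat `prim-pcint-1` (gen 8); support file (`--supports stmt-CriticalPhenomena-4575`).
Does NOT build on p205010.  Memo: run/shared/lean/prim/pcint/REDUCTIONS.md §B2d; prim-pcint-1/gen8/README.md ("Kernel cost anatomy").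

Same automaton, same soundness chain as `…NawFreeMemKernelCert`, but a cheaper ROW CHECK.  The table (`NawK.WT`) carries, besides
the Collatz–Wielandt weight, the state and the successor data of `NawK.NT`, a list of CLAIMED PAYMENTS per letter: unconditional
claims `(w, np, cn)` (site relative to the new vertex, number of payments, count) and at most one corner claim.  The kernel verifies
each claim with the existing mirrors evaluated at the claimed site only (`fnpayK`, `fcntK`, `funcondK`, `fcornerK` of
`…NawFreeMemKernel`) and charges nothing for unclaimed sites; by the claim bounds of `…NawFreeMemClaims` the claimed weight dominates
`fwt`, so the Collatz–Wielandt inequality checked on claimed weights implies the one the table theorem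
`le_siteCriticalProb_zd_of_freeMemTable` needs.  Main theorem: **`NawK.le_siteCriticalProb_of_checkRowsW`** (same hypotheses and
conclusion as `NawK.le_siteCriticalProb_of_checkRowsF`, with `checkRowW` for `checkRowF`).
-/

namespace Summit.CriticalPhenomena.PercolationContinuityZ3.Theorems.Pcint

open Finset Literature.Probability.Percolation Literature.Probability.LatticeModels

namespace NawK

open WinK (toSite toL addL adjL toSite_addL toSite_toL adj_iff_adjL toSite_inj length_toL length_addL)

variable {d : ℕ}

/-! ### Tables with claims -/

/-- A payment claim: (site as an integer list relative to the new vertex, number of payments, claimed count). [folklore] -/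
abbrev UClaim : Type := List ℤ × ℕ × ℕ

/-- The claims of one letter: unconditional claims and at most one corner claim. [folklore] -/
abbrev LClaims : Type := List UClaim × Option UClaim

/-- Row payload with claims: weight, state, per-letter successor data, per-letter claims. [folklore] -/
abbrev PayloadW : Type := ℕ × KState × List (Option (ℕ × ℕ)) × List LClaims

/-- Certificate table with claims, as a search tree keyed by row index. [folklore] -/
inductive WT where
  | leaf : WT
  | node : WT → ℕ → PayloadW → WT → WT

/-- Lookup by row index. [folklore] -/
def WT.find (i : ℕ) : WT → Option PayloadW
  | WT.leaf => none
  | WT.node l k v r => if i < k then l.find i else if k < i then r.find i else some v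

/-- Forget the claims: the underlying `NT` table. [folklore] -/
def WT.toNT : WT → NT
  | WT.leaf => NT.leaf
  | WT.node l k v r => NT.node l.toNT k (v.1, v.2.1, v.2.2.1) r.toNT

/-- Grafting lemma for `WT.find` (for splitting big tables over files). [folklore] -/
theorem WT.find_node (l r : WT) (k : ℕ) (v : PayloadW) (i : ℕ) :
    (WT.node l k v r).find i = if i < k then l.find i else if k < i then r.find i else some v := rfl

/-- Lookups in the underlying table are the projected lookups. [folklore] -/
theorem WT.find_toNT (i : ℕ) : ∀ t : WT, t.toNT.find i = (t.find i).map fun v => (v.1, v.2.1, v.2.2.1)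
  | WT.leaf => rfl
  | WT.node l k v r => by
    rw [WT.toNT, NT.find, WT.find, WT.find_toNT i l, WT.find_toNT i r]
    split_ifs <;> rfl

section CheckW

variable (τ kt d N pn D lamN lamD : ℕ) (QL : List ℕ) (syms : List (List (ℕ × Bool))) (wt : WT)

/-- An unconditional claim is valid: its site is a length-`d` neighbour of the pseudo-tip, not a known position, unconditional,
with `np ≤ fnpay` and `fcnt ≤ cn`. [folklore] -/
def claimOKU (K : KState) (P : List ℤ) (c : UClaim) : Bool :=
  decide (c.1.length = d) && adjL d P c.1 && !isPosK K c.1 && decide (c.2.1 ≤ fnpayK τ kt d K c.1) &&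
    decide (fcntK τ d K c.1 ≤ c.2.2) && funcondK d K c.1

/-- A corner claim is valid: its site is a length-`d` neighbour of the pseudo-tip, not a known position, the syntactic corner, with
`1 ≤ np ≤ fnpay` and `fcnt ≤ cn`. [folklore] -/
def claimOKC (K : KState) (P : List ℤ) (c : UClaim) : Bool :=
  decide (c.1.length = d) && adjL d P c.1 && !isPosK K c.1 && decide (1 ≤ c.2.1) && decide (c.2.1 ≤ fnpayK τ kt d K c.1) &&
    decide (fcntK τ d K c.1 ≤ c.2.2) && fcornerK kt K c.1

/-- The claims of a letter are valid: a pseudo-tip exists (or there are no claims), at most `2d` unconditional claims, every claim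
valid, and the claimed sites pairwise distinct. [folklore] -/
def claimsOK (K : KState) (cl : LClaims) : Bool :=
  match posAtK K kt with
  | none => cl.1.isEmpty && cl.2.isNone
  | some P => decide (cl.1.length ≤ 2 * d) && cl.1.all (claimOKU τ kt d K P) &&
      (match cl.2 with | none => true | some c => claimOKC τ kt d K P c) &&
      decide ((cl.1.map Prod.fst ++ cl.2.toList.map Prod.fst).Nodup)

/-- Claimed unconditional numerator over `D^{4d}`. [folklore] -/
def uNumW (ucl : List UClaim) : ℕ :=
  (ucl.map fun c => Qn D QL c.2.2 ^ c.2.1 * D ^ (2 - c.2.1)).prod * D ^ (2 * (2 * d - ucl.length))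

/-- Claimed corner factor over `2 D^{4d}`: `2 D^{4d}` (no corner claim) or `D^{4d} + Q_{cn}^{np} D^{2-np} D^{4d-2}`. [folklore] -/
def fNumW (oc : Option UClaim) : ℕ :=
  match oc with
  | none => 2 * D ^ (4 * d)
  | some c => D ^ (4 * d) + Qn D QL c.2.2 ^ c.2.1 * D ^ (2 - c.2.1) * D ^ (4 * d - 2)

/-- Integer value of one letter with claimed weights: `pn · U · F · V_j` (it does not depend on the state). [folklore] -/
def termValW (os : Option (ℕ × ℕ)) (cl : LClaims) : ℕ :=
  match os with
  | none => 0
  | some jc => pn * uNumW d D QL cl.1 * fNumW d D QL cl.2 * vOf wt.toNT jc.1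

/-- Integer row sum with claimed weights. [folklore] -/
def rowValW (sc : ℕ → Option (ℕ × ℕ)) (cls : ℕ → LClaims) : ℕ :=
  ((letters d).map fun a => termValW d pn D QL wt (sc (letterIdx a)) (cls (letterIdx a))).sum

/-- **Row check with claims**: well-formed state, valid ages, `V ≥ 1`, matching successors, valid claims, and
`lamD · Σ ≤ lamN · 2 · D^{8d+1} · V` on the CLAIMED weights. [folklore] -/
def checkRowW (i : ℕ) : Bool :=
  match wt.find i with
  | none => false
  | some v =>
    WF d v.2.1 && AOK v.2.1 && decide (1 ≤ v.1) &&
      (letters d).all (fun a => termOK τ d N syms wt.toNT v.2.1 a (v.2.2.1.getD (letterIdx a) none)) &&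
      (letters d).all (fun a => claimsOK τ kt d (fKK d v.2.1 a) (v.2.2.2.getD (letterIdx a) ([], none))) &&
      decide (lamD * rowValW d pn D QL wt (fun k => v.2.2.1.getD k none) (fun k => v.2.2.2.getD k ([], none)) ≤
        lamN * 2 * D ^ (8 * d + 1) * v.1)

end CheckW

/-! ### Soundness -/

section SoundW

variable {τ kt d N pn D lamN lamD : ℕ} {QL : List ℕ} {syms : List (List (ℕ × Bool))} {wt : WT}

/-- What a passed row check says. [folklore] -/
theorem checkRowW_spec {i : ℕ} (h : checkRowW τ kt d N pn D lamN lamD QL syms wt i = true) :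
    ∃ v, wt.find i = some v ∧ WF d v.2.1 = true ∧ AOK v.2.1 = true ∧ 1 ≤ v.1 ∧
      (∀ a, termOK τ d N syms wt.toNT v.2.1 a (v.2.2.1.getD (letterIdx a) none) = true) ∧
      (∀ a, claimsOK τ kt d (fKK d v.2.1 a) (v.2.2.2.getD (letterIdx a) ([], none)) = true) ∧
      lamD * rowValW d pn D QL wt (fun k => v.2.2.1.getD k none) (fun k => v.2.2.2.getD k ([], none)) ≤
        lamN * 2 * D ^ (8 * d + 1) * v.1 := by
  unfold checkRowW at h
  cases hf : wt.find i with
  | none => rw [hf] at h; exact Bool.noConfusion h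
  | some v =>
    rw [hf] at h
    simp only [Bool.and_eq_true, decide_eq_true_eq, List.all_eq_true] at h
    obtain ⟨⟨⟨⟨⟨hwf, hA⟩, hv⟩, hall⟩, hcl⟩, hineq⟩ := h
    exact ⟨v, rfl, hwf, hA, hv, fun a => hall a (mem_letters a), fun a => hcl a (mem_letters a), hineq⟩

/-- A product of termwise-dominated nonnegative factors is dominated. [folklore] -/
theorem list_prod_map_le {α : Type*} {l : List α} {f g : α → ℝ} (h0 : ∀ x ∈ l, 0 ≤ f x) (h : ∀ x ∈ l, f x ≤ g x) :
    (l.map f).prod ≤ (l.map g).prod := by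
  induction l with
  | nil => simp
  | cons y ys ih =>
    simp only [List.map_cons, List.prod_cons]
    have hy0 : 0 ≤ f y := h0 y (by simp)
    have hys0 : 0 ≤ (ys.map f).prod := List.prod_nonneg fun x hx => by
      obtain ⟨z, hz, rfl⟩ := List.mem_map.1 hx; exact h0 z (by simp [hz])
    exact mul_le_mul (h y (by simp)) (ih (fun x hx => h0 x (by simp [hx])) fun x hx => h x (by simp [hx])) hys0
      (hy0.trans (h y (by simp)))

/-- **List form of the claim bound**: unconditional claims with distinct sites, and optionally the corner claim. [folklore] -/
theorem fwt_le_list_claims {qv : ℕ → ℝ} (hq0 : ∀ k, 0 ≤ qv k) (hq1 : ∀ k, qv k ≤ 1)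
    (hmono : ∀ k k', k ≤ k' → qv k ≤ qv k') {S : MState d} {a : Fin d × Bool} (ws : List (Site d × ℕ × ℕ))
    (hnd : (ws.map Prod.fst).Nodup) (hsub : ∀ x ∈ ws, x.1 ∈ fsites kt S a) (hunc : ∀ x ∈ ws, funcond S a x.1 = true)
    (hnp : ∀ x ∈ ws, x.2.1 ≤ fnpay τ kt S a x.1) (hcn : ∀ x ∈ ws, fcnt τ S a x.1 ≤ x.2.2)
    (oc : Option (Site d × ℕ × ℕ))
    (hoc : ∀ x, oc = some x → x.1 ∈ fsites kt S a ∧ x.1 ∉ ws.map Prod.fst ∧ fcorner kt S a x.1 = true ∧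
      x.2.1 ≤ fnpay τ kt S a x.1 ∧ 1 ≤ x.2.1 ∧ fcnt τ S a x.1 ≤ x.2.2) :
    fwt τ kt qv S a ≤ (ws.map fun x => qv x.2.2 ^ x.2.1).prod * oc.elim 1 (fun x => (1 + qv x.2.2 ^ x.2.1) / 2) := by
  classical
  set PU : ℝ := (ws.map fun x => qv x.2.2 ^ x.2.1).prod with hPU
  have hUn : 0 ≤ PU :=
    List.prod_nonneg fun y hy => by obtain ⟨x, -, rfl⟩ := List.mem_map.1 hy; exact pow_nonneg (hq0 _) _
  have hsubU : (ws.map Prod.fst).toFinset ⊆ fsites kt S a := fun w hw => by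
    obtain ⟨x, hx, rfl⟩ := List.mem_map.1 (List.mem_toFinset.1 hw); exact hsub x hx
  have hlist : (((ws.map Prod.fst).toFinset).prod fun w =>
      if funcond S a w then qv (fcnt τ S a w) ^ fnpay τ kt S a w else (1 : ℝ)) ≤ PU := by
    rw [List.prod_toFinset _ hnd, List.map_map]
    refine list_prod_map_le (fun x _ => ite_pow_nonneg hq0 _ _ _) fun x hx => ?_
    simp only [Function.comp_apply]
    rw [if_pos (hunc x hx)]
    exact pow_fcnt_le_claim hq0 hq1 hmono (hnp x hx) (hcn x hx)
  have hU : fU τ kt qv S a ≤ PU := by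
    unfold fU
    exact (prod_le_prod_of_subset_of_le_one_real hsubU (fun w _ => ite_pow_nonneg hq0 _ _ _)
      fun w _ => ite_pow_le_one hq0 hq1 _ _ _).trans hlist
  have hgp := fwt_cpart_nonneg (τ := τ) (kt := kt) hq0 S a
  have hg1 := fwt_cpart_le_one (τ := τ) (kt := kt) hq0 hq1 S a
  cases oc with
  | none =>
    show fwt τ kt qv S a ≤ PU * 1
    unfold fwt
    exact mul_le_mul hU hg1 hgp hUn
  | some x =>
    obtain ⟨hw₀, hw₀U, hcor, hnp₀, hnp₀', hcn₀⟩ := hoc x rfl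
    set c : ℝ := qv x.2.2 ^ x.2.1 with hc
    set c' : ℝ := qv (fcnt τ S a x.1) ^ fnpay τ kt S a x.1 with hc'
    have hc'c : c' ≤ c := pow_fcnt_le_claim hq0 hq1 hmono hnp₀ hcn₀
    have hc1 : c ≤ 1 := pow_le_one₀ (hq0 _) (hq1 _)
    have hc'0 : 0 ≤ c' := pow_nonneg (hq0 _) _
    have hcm : c ≤ (1 + c) / 2 := by linarith
    have hw₀T : x.1 ∉ (ws.map Prod.fst).toFinset := fun h => hw₀U (List.mem_toFinset.1 h)
    show fwt τ kt qv S a ≤ PU * ((1 + c) / 2)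
    unfold fwt
    by_cases hunc0 : funcond S a x.1 = true
    · have hsub' : insert x.1 (ws.map Prod.fst).toFinset ⊆ fsites kt S a := insert_subset hw₀ hsubU
      have hU' : fU τ kt qv S a ≤ c' * PU := by
        unfold fU
        refine (prod_le_prod_of_subset_of_le_one_real hsub' (fun w _ => ite_pow_nonneg hq0 _ _ _)
          fun w _ => ite_pow_le_one hq0 hq1 _ _ _).trans ?_
        rw [prod_insert hw₀T, if_pos hunc0]
        exact mul_le_mul_of_nonneg_left hlist hc'0
      calc fU τ kt qv S a * (if fhasC τ kt S a then (1 + fC τ kt qv S a) / 2 else 1)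
          ≤ c' * PU * 1 := mul_le_mul hU' hg1 hgp (mul_nonneg hc'0 hUn)
        _ ≤ (1 + c) / 2 * PU := by rw [mul_one]; exact mul_le_mul_of_nonneg_right (hc'c.trans hcm) hUn
        _ = PU * ((1 + c) / 2) := mul_comm _ _
    · rw [Bool.not_eq_true] at hunc0
      have hcond : fcond kt S a x.1 = true := (fcond_iff kt).2 ⟨hunc0, hcor⟩
      have hpay : fnpay τ kt S a x.1 ≠ 0 := by omega
      have hhas : fhasC τ kt S a = true := (fhasC_iff τ kt).2 ⟨x.1, hw₀, hcond, hpay⟩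
      have hCle : fC τ kt qv S a ≤ c' := by
        unfold fC
        refine (prod_le_prod_of_subset_of_le_one_real (singleton_subset_iff.2 hw₀) (fun w _ => ite_pow_nonneg hq0 _ _ _)
          fun w _ => ite_pow_le_one hq0 hq1 _ _ _).trans ?_
        rw [prod_singleton, if_pos hcond]
      rw [if_pos hhas]
      have hCn := fC_nonneg (τ := τ) (kt := kt) hq0 S a
      exact mul_le_mul hU (by linarith) (by linarith) hUn

/-- Real value of a claimed site numerator: `Q^n D^{2-n} / D² = (Q/D)^n` for `n ≤ 2`. [folklore] -/
theorem claimNum_real (hD : (0 : ℝ) < D) {Q n : ℕ} (hn : n ≤ 2) :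
    ((Q ^ n * D ^ (2 - n) : ℕ) : ℝ) / (D : ℝ) ^ 2 = ((Q : ℝ) / D) ^ n := by
  rw [div_pow]
  push_cast
  have e1 : (D : ℝ) ^ 2 = (D : ℝ) ^ n * (D : ℝ) ^ (2 - n) := by rw [← pow_add]; congr 1; omega
  rw [e1]
  field_simp

/-- A length-`d` site adjacent to the pseudo-tip and not a known position is a kernel inspected site. [folklore] -/
theorem mem_fsitesK_of_adjL {kt : ℕ} {K : KState} {P w : List ℤ} (hKP : posAtK K kt = some P) (hP : P.length = d)
    (hw : w.length = d) (hadj : adjL d P w = true) (hpos : isPosK K w = false) : w ∈ fsitesK kt d K := by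
  unfold fsitesK; rw [hKP]
  refine List.mem_filter.2 ⟨?_, by rw [hpos]; rfl⟩
  obtain ⟨h1, -⟩ := nbrL_toFinset (d := d) hP
  have hadj' : (zdGraph d).Adj (toSite P : Site d) (toSite w) := (adj_iff_adjL hP hw).2 hadj
  have hmem : (toSite w : Site d) ∈ ((nbrL d P).map (toSite (d := d))).toFinset := by rw [h1]; exact mem_nbrSites.2 hadj'
  obtain ⟨u, hu, hue⟩ := List.mem_map.1 (List.mem_toFinset.1 hmem)
  have : u = w := toSite_inj (length_of_mem_nbrL hP hu) hw hue
  rw [← this]; exact hu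

/-- **The claimed weight dominates the step factor** (for the table weight family `qv k = Q_k / D`). [folklore] -/
theorem fwt_le_claimW [NeZero d] (hD : (0 : ℝ) < D) (hQle : ∀ k, Qn D QL k ≤ D)
    (hQmono : ∀ k k', k ≤ k' → Qn D QL k ≤ Qn D QL k') {L : KState} (hL : WF d L = true) (hA : AOK L = true)
    (a : Fin d × Bool) {cl : LClaims} (hok : claimsOK τ kt d (fKK d L a) cl = true) :
    fwt τ kt (fun k => (Qn D QL k : ℝ) / D) (toM L : MState d) a ≤
      (uNumW d D QL cl.1 : ℝ) / (D : ℝ) ^ (4 * d) * ((fNumW d D QL cl.2 : ℝ) / (2 * (D : ℝ) ^ (4 * d))) := by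
  classical
  set qv : ℕ → ℝ := fun k => (Qn D QL k : ℝ) / D with hqv
  have hq0 : ∀ k, 0 ≤ qv k := fun k => div_nonneg (Nat.cast_nonneg _) hD.le
  have hq1 : ∀ k, qv k ≤ 1 := fun k => div_le_one_of_le₀ (by exact_mod_cast hQle k) hD.le
  have hmono : ∀ k k', k ≤ k' → qv k ≤ qv k' := fun k k' h =>
    div_le_div_of_nonneg_right (by exact_mod_cast hQmono k k' h) hD.le
  have hD4 : (0 : ℝ) < (D : ℝ) ^ (4 * d) := pow_pos hD _
  have hd1 : 1 ≤ d := Nat.one_le_iff_ne_zero.2 (NeZero.ne d)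
  have hWF := WF_fKK hL a
  unfold claimsOK at hok
  cases hP : posAtK (fKK d L a) kt with
  | none =>
    rw [hP] at hok
    simp only [Bool.and_eq_true, List.isEmpty_iff, Option.isNone_iff_eq_none] at hok
    obtain ⟨h1, h2⟩ := hok
    rw [h1, h2, uNumW, fNumW]
    simp only [List.map_nil, List.prod_nil, List.length_nil, Nat.sub_zero, one_mul]
    push_cast
    rw [show 2 * (2 * d) = 4 * d by ring, div_self hD4.ne', one_mul, div_self (by positivity)]
    exact fwt_le_one hq0 hq1 _ _
  | some P =>
    rw [hP] at hok
    simp only [Bool.and_eq_true, decide_eq_true_eq, List.all_eq_true] at hok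
    obtain ⟨⟨⟨hlen, hall⟩, hcor⟩, hnd⟩ := hok
    have mP := (posAtK_eq_some_iff hA).1 hP
    have lP : P.length = d := length_of_WF hWF mP
    obtain ⟨hfs, -⟩ := fsites_eq_toFinset (kt := kt) (a := a) hL hA
    have hsite : ∀ {w : List ℤ}, w.length = d → adjL d P w = true → isPosK (fKK d L a) w = false →
        (toSite w : Site d) ∈ fsites kt (toM L : MState d) a := by
      intro w hw hadj hpos
      rw [hfs]; exact List.mem_toFinset.2 (List.mem_map.2 ⟨_, mem_fsitesK_of_adjL hP lP hw hadj hpos, rfl⟩)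
    -- facts about the unconditional claims
    have hU : ∀ c ∈ cl.1, c.1.length = d ∧ (toSite c.1 : Site d) ∈ fsites kt (toM L : MState d) a ∧
        funcond (toM L : MState d) a (toSite c.1) = true ∧ c.2.1 ≤ fnpay τ kt (toM L : MState d) a (toSite c.1) ∧
        fcnt τ (toM L : MState d) a (toSite c.1) ≤ c.2.2 := by
      intro c hc
      have h := hall c hc
      unfold claimOKU at h
      simp only [Bool.and_eq_true, Bool.not_eq_true', decide_eq_true_eq] at h
      obtain ⟨⟨⟨⟨⟨hwl, hadj⟩, hpos⟩, hnp⟩, hcn⟩, hunc⟩ := h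
      exact ⟨hwl, hsite hwl hadj hpos, by rw [← funcondK_eq hL hwl]; exact hunc, by rw [← fnpayK_eq hL hA hwl]; exact hnp,
        by rw [← fcntK_eq hL hA hwl]; exact hcn⟩
    -- the semantic claim list
    set ws : List (Site d × ℕ × ℕ) := cl.1.map fun c => ((toSite c.1 : Site d), c.2.1, c.2.2) with hws
    have hws_fst : ws.map Prod.fst = (cl.1.map Prod.fst).map (toSite (d := d)) := by
      rw [hws, List.map_map, List.map_map]; rfl
    have hndK : (cl.1.map Prod.fst).Nodup := (List.nodup_append.1 hnd).1
    have hinj : ∀ x ∈ cl.1.map Prod.fst, ∀ y ∈ cl.1.map Prod.fst, (toSite x : Site d) = toSite y → x = y := by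
      intro x hx y hy h
      obtain ⟨cx, hcx, rfl⟩ := List.mem_map.1 hx
      obtain ⟨cy, hcy, rfl⟩ := List.mem_map.1 hy
      exact toSite_inj (hU cx hcx).1 (hU cy hcy).1 h
    have hndws : (ws.map Prod.fst).Nodup := by rw [hws_fst]; exact hndK.map_on hinj
    have hmem : ∀ x ∈ ws, ∃ c ∈ cl.1, x = ((toSite c.1 : Site d), c.2.1, c.2.2) := fun x hx => by
      obtain ⟨c, hc, rfl⟩ := List.mem_map.1 hx; exact ⟨c, hc, rfl⟩
    have hsub' : ∀ x ∈ ws, x.1 ∈ fsites kt (toM L : MState d) a := fun x hx => by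
      obtain ⟨c, hc, rfl⟩ := hmem x hx; exact (hU c hc).2.1
    have hunc' : ∀ x ∈ ws, funcond (toM L : MState d) a x.1 = true := fun x hx => by
      obtain ⟨c, hc, rfl⟩ := hmem x hx; exact (hU c hc).2.2.1
    have hnp' : ∀ x ∈ ws, x.2.1 ≤ fnpay τ kt (toM L : MState d) a x.1 := fun x hx => by
      obtain ⟨c, hc, rfl⟩ := hmem x hx; exact (hU c hc).2.2.2.1
    have hcn' : ∀ x ∈ ws, fcnt τ (toM L : MState d) a x.1 ≤ x.2.2 := fun x hx => by
      obtain ⟨c, hc, rfl⟩ := hmem x hx; exact (hU c hc).2.2.2.2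
    -- the unconditional numerator, as a real
    have hlenU : (cl.1.map fun c : UClaim => Qn D QL c.2.2 ^ c.2.1 * D ^ (2 - c.2.1)).length = cl.1.length :=
      List.length_map _
    have hUreal : (uNumW d D QL cl.1 : ℝ) / (D : ℝ) ^ (4 * d) = (ws.map fun x => qv x.2.2 ^ x.2.1).prod := by
      rw [uNumW, show 4 * d = 2 * (2 * d) by ring, prod_pad_real hD _ _ (2 * d) hlenU hlen, List.map_map, hws,
        List.map_map]
      refine congrArg List.prod (List.map_congr_left fun c hc => ?_)
      have hn2 : c.2.1 ≤ 2 := (hU c hc).2.2.2.1.trans (fnpay_le_two _ _ _ _ _)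
      simp only [Function.comp_apply]
      rw [claimNum_real hD hn2]
    -- the corner claim, semantically
    set oc : Option (Site d × ℕ × ℕ) := cl.2.map fun c => ((toSite c.1 : Site d), c.2.1, c.2.2) with hoc
    have hoc' : ∀ x, oc = some x → x.1 ∈ fsites kt (toM L : MState d) a ∧ x.1 ∉ ws.map Prod.fst ∧
        fcorner kt (toM L : MState d) a x.1 = true ∧ x.2.1 ≤ fnpay τ kt (toM L : MState d) a x.1 ∧ 1 ≤ x.2.1 ∧
        fcnt τ (toM L : MState d) a x.1 ≤ x.2.2 := by
      intro x hx
      cases h2 : cl.2 with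
      | none => rw [hoc, h2] at hx; exact absurd hx (by simp)
      | some c =>
        rw [hoc, h2, Option.map_some] at hx
        have hxe : x = ((toSite c.1 : Site d), c.2.1, c.2.2) := (Option.some.inj hx).symm
        rw [h2] at hcor hnd
        unfold claimOKC at hcor
        simp only [Bool.and_eq_true, Bool.not_eq_true', decide_eq_true_eq] at hcor
        obtain ⟨⟨⟨⟨⟨⟨hwl, hadj⟩, hpos⟩, hnp1⟩, hnp⟩, hcn⟩, hcorn⟩ := hcor
        have hnotin : (toSite c.1 : Site d) ∉ ws.map Prod.fst := by
          rw [hws_fst]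
          intro hm
          obtain ⟨y, hy, hye⟩ := List.mem_map.1 hm
          obtain ⟨cy, hcy, rfl⟩ := List.mem_map.1 hy
          have hyc : cy.1 = c.1 := toSite_inj (hU cy hcy).1 hwl hye
          simp only [Option.toList_some, List.map_cons, List.map_nil] at hnd
          have hdis := List.disjoint_of_nodup_append hnd
          exact hdis hy (by simp [hyc])
        rw [hxe]
        exact ⟨hsite hwl hadj hpos, hnotin, by rw [← fcornerK_eq hL hA hwl]; exact hcorn,
          by rw [← fnpayK_eq hL hA hwl]; exact hnp, hnp1, by rw [← fcntK_eq hL hA hwl]; exact hcn⟩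
    have hFreal : (fNumW d D QL cl.2 : ℝ) / (2 * (D : ℝ) ^ (4 * d)) = oc.elim 1 (fun x => (1 + qv x.2.2 ^ x.2.1) / 2) := by
      cases h2 : cl.2 with
      | none =>
        have hon : oc = none := by rw [hoc, h2]; rfl
        rw [hon, fNumW, Option.elim]; push_cast; field_simp
      | some c =>
        have hocs : oc = some ((toSite c.1 : Site d), c.2.1, c.2.2) := by rw [hoc, h2]; rfl
        obtain ⟨-, -, -, hnp, -, -⟩ := hoc' _ hocs
        have hn2 : c.2.1 ≤ 2 := hnp.trans (fnpay_le_two _ _ _ _ _)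
        rw [hocs, fNumW, Option.elim]
        simp only [hqv]
        rw [div_pow]
        push_cast
        have e1 : (D : ℝ) ^ (4 * d) = (D : ℝ) ^ c.2.1 * ((D : ℝ) ^ (2 - c.2.1) * (D : ℝ) ^ (4 * d - 2)) := by
          rw [← pow_add, ← pow_add]; congr 1; omega
        rw [e1]
        field_simp
    rw [hUreal, hFreal]
    exact fwt_le_list_claims hq0 hq1 hmono ws hndws hsub' hunc' hnp' hcn' oc hoc'

end SoundW

end NawK

end Summit.CriticalPhenomena.PercolationContinuityZ3.Theorems.Pcint
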